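import Summits.KontsevichZagierPeriods.KontsevichZagierPeriods.Theorems.HyperbolicBlochOffTetraSectorKernelRungZeroLogRelations

/-!
# `OffTetraSectorKernel` (stmt-KontsevichZagierPeriods-10557), line `odd-hyperbolic-ladder`: stub `stub_logSheetPower`

**RUNG `0`: `log r^k = k · log r` AS MOVES, FOR THE SIGNED LOG SHEET.** For real-algebraic `r > 0` the
signed log sheet is `Λ±(r) = [{1 < t < r} ∪ {r < t < 1}, sgn(t − 1)/t]` (value `log r` for every
`r > 0`). We prove `[Λ±(r^k)] − k • [Λ±(r)] ∈ KZ.relations` by reduction to the landed rung-`0`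
relation `interval_log_relation_mem_relations` (every `ℤ`-linear relation among hyperbolic lengths
`log (β/α)` of `ℚ̄`-intervals `{α < t < β}` is a Kontsevich–Zagier relation among the interval
representations `[{α < t < β}, dt/t]`):

* `r ≥ 1`: the sheets ARE the interval representations `[{1 < t < r}, dt/t]`, `[{1 < t < r^k}, dt/t]`
  (the second pieces `{r < t < 1}` are empty, and `sgn(t − 1) = 1` on the first), and
  `log r^k − k log r = 0`;
* `r ≤ 1`: the sheets are `[{r < t < 1}, −dt/t]`, `[{r^k < t < 1}, −dt/t]`, the NEGATIVES
  (`KZ.IntegralRep.neg`, `[ρ] + [ρ.neg] ∈ KZ.relations`) of interval representations, and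
  `log (1/r^k) − k log (1/r) = 0`.

References: M. Kontsevich, D. Zagier, *Periods* (2001), §1.1 (`log 2 = ∫₁² dx/x`), §1.2, rules (1), (2);
A. B. Goncharov, *Volumes of hyperbolic manifolds and mixed Tate motives* (1999), §1.7.
No new definitions.
-/

noncomputable section

open Set MeasureTheory
open Literature.NumberTheory.Transcendental

namespace Summit.KontsevichZagierPeriods.HyperbolicBloch.OffTetraSectorKernel

/-- Two interval representations `A = [{a < t < b}, dt/t]`, `B = [{c < t < d}, dt/t]` with real-algebraic
end points `0 < a ≤ b`, `0 < c ≤ d` and `log (d/c) = k · log (b/a)` satisfy `[B] − k • [A] ∈ KZ.relations`: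
the case `Σ mᵢ log (βᵢ/αᵢ) = 0` with `m = (1, −k)` of the rung-`0` relation
`interval_log_relation_mem_relations`. [cite: KontsevichZagier2001, §1.2] -/
theorem logSheetPower_interval_sub_nsmul_mem_relations (k : ℕ) {a b c d : ℝ} (ha : 0 < a)
    (hab : a ≤ b) (hc : 0 < c) (hcd : c ≤ d) (halga : IsAlgebraic ℚ a) (halgb : IsAlgebraic ℚ b)
    (halgc : IsAlgebraic ℚ c) (halgd : IsAlgebraic ℚ d) (A B : KZ.IntegralRep 1)
    (hAd : A.domain = {p : Fin 1 → ℝ | a < p 0 ∧ p 0 < b})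
    (hAi : EqOn A.integrand (fun p : Fin 1 → ℝ => 1 / p 0) A.domain)
    (hBd : B.domain = {p : Fin 1 → ℝ | c < p 0 ∧ p 0 < d})
    (hBi : EqOn B.integrand (fun p : Fin 1 → ℝ => 1 / p 0) B.domain)
    (hlog : Real.log (d / c) = k * Real.log (b / a)) :
    KZ.of B - k • KZ.of A ∈ KZ.relations := by
  have h := interval_log_relation_mem_relations 2 ![c, a] ![d, b] ![1, -(k : ℤ)] ![B, A]
    (Fin.forall_fin_two.2 ⟨hc, ha⟩) (Fin.forall_fin_two.2 ⟨hcd, hab⟩)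
    (Fin.forall_fin_two.2 ⟨halgc, halga⟩) (Fin.forall_fin_two.2 ⟨halgd, halgb⟩)
    (Fin.forall_fin_two.2 ⟨⟨hBd, hBi⟩, ⟨hAd, hAi⟩⟩)
    (by
      rw [Fin.sum_univ_two]
      simp only [Matrix.cons_val_zero, Matrix.cons_val_one, Int.cast_one, Int.cast_neg,
        Int.cast_natCast, hlog]
      ring)
  rw [Fin.sum_univ_two] at h
  simpa only [Matrix.cons_val_zero, Matrix.cons_val_one, Matrix.head_cons, one_zsmul, neg_zsmul,
    natCast_zsmul, ← sub_eq_add_neg] using h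

/-- STUB `stub_logSheetPower` (rung 0: `log r^k = k log r` for the signed log sheet `Λ±`): reduce, by cases `r ≥ 1`,
`r ≤ 1`, to the landed interval relation `interval_log_relation_mem_relations` (for `r ≤ 1` the sheet is
`{r < t < 1}` with integrand `−1/t`, the negative of an interval representation: `KZ.of_add_of_mem_relations_of_eqOn_neg`;
for `r = 1` both sheets are empty). [cite: KontsevichZagier2001, §1.2] -/
theorem stub_logSheetPower :
    ∀ (k : ℕ), 1 ≤ k → ∀ (r : ℝ), IsAlgebraic ℚ r → 0 < r →
    ∀ (L Lk : KZ.IntegralRep 1),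
      L.domain = {t | (1 < t 0 ∧ t 0 < r) ∨ (r < t 0 ∧ t 0 < 1)} →
      Set.EqOn L.integrand (fun t => (if 1 < t 0 then (1 : ℝ) else -1) / t 0) L.domain →
      Lk.domain = {t | (1 < t 0 ∧ t 0 < r ^ k) ∨ (r ^ k < t 0 ∧ t 0 < 1)} →
      Set.EqOn Lk.integrand (fun t => (if 1 < t 0 then (1 : ℝ) else -1) / t 0) Lk.domain →
      KZ.of Lk - k • KZ.of L ∈ KZ.relations := by
  intro k _ r hr hr0 L Lk hLd hLi hLkd hLki
  have hrk : IsAlgebraic ℚ (r ^ k) := hr.pow k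
  have hrk0 : 0 < r ^ k := pow_pos hr0 k
  -- the two one-sided shapes of a signed sheet `[{1 < t < q} ∪ {q < t < 1}, sgn(t − 1)/t]`
  have upper : ∀ (q : ℝ) (M : KZ.IntegralRep 1), 1 ≤ q →
      M.domain = {t | (1 < t 0 ∧ t 0 < q) ∨ (q < t 0 ∧ t 0 < 1)} →
      EqOn M.integrand (fun t => (if 1 < t 0 then (1 : ℝ) else -1) / t 0) M.domain →
      M.domain = {p : Fin 1 → ℝ | 1 < p 0 ∧ p 0 < q} ∧
        EqOn M.integrand (fun p : Fin 1 → ℝ => 1 / p 0) M.domain := by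
    intro q M h1q hMd hMi
    have hMd' : M.domain = {p : Fin 1 → ℝ | 1 < p 0 ∧ p 0 < q} := by
      rw [hMd]
      ext p
      simp only [mem_setOf_eq]
      refine ⟨?_, Or.inl⟩
      rintro (h | h)
      · exact h
      · exact absurd (h.1.trans h.2) (not_lt.2 h1q)
    refine ⟨hMd', fun p hp => ?_⟩
    have h1p : 1 < p 0 := by
      rw [hMd'] at hp
      exact hp.1
    have h := hMi hp
    simp only [if_pos h1p] at h
    exact h
  have lower : ∀ (q : ℝ) (M : KZ.IntegralRep 1), q ≤ 1 →
      M.domain = {t | (1 < t 0 ∧ t 0 < q) ∨ (q < t 0 ∧ t 0 < 1)} →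
      EqOn M.integrand (fun t => (if 1 < t 0 then (1 : ℝ) else -1) / t 0) M.domain →
      M.neg.domain = {p : Fin 1 → ℝ | q < p 0 ∧ p 0 < 1} ∧
        EqOn M.neg.integrand (fun p : Fin 1 → ℝ => 1 / p 0) M.neg.domain := by
    intro q M hq1 hMd hMi
    have hMd' : M.domain = {p : Fin 1 → ℝ | q < p 0 ∧ p 0 < 1} := by
      rw [hMd]
      ext p
      simp only [mem_setOf_eq]
      refine ⟨?_, Or.inr⟩
      rintro (h | h)
      · exact absurd (h.1.trans h.2) (not_lt.2 hq1)
      · exact h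
    refine ⟨hMd', fun p hp => ?_⟩
    have hp' : p ∈ M.domain := hp
    have hp1 : p 0 < 1 := by
      rw [hMd'] at hp'
      exact hp'.2
    have h := hMi hp'
    simp only [if_neg (not_lt.2 hp1.le)] at h
    simp only [KZ.IntegralRep.integrand_neg, Pi.neg_apply, h, neg_div, neg_neg]
  rcases le_total 1 r with h1r | hr1
  · -- `r ≥ 1`: the sheets are the interval representations `(1, r)`, `(1, r^k)` with `dt/t`
    obtain ⟨hLd', hLi'⟩ := upper r L h1r hLd hLi
    obtain ⟨hLkd', hLki'⟩ := upper (r ^ k) Lk (one_le_pow₀ h1r) hLkd hLki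
    refine logSheetPower_interval_sub_nsmul_mem_relations k one_pos h1r one_pos (one_le_pow₀ h1r)
      isAlgebraic_one hr isAlgebraic_one hrk L Lk hLd' hLi' hLkd' hLki' ?_
    rw [div_one, div_one, Real.log_pow]
  · -- `r ≤ 1`: the NEGATED sheets are the interval representations `(r, 1)`, `(r^k, 1)` with `dt/t`
    have hrk1 : r ^ k ≤ 1 := pow_le_one₀ hr0.le hr1
    obtain ⟨hLd', hLi'⟩ := lower r L hr1 hLd hLi
    obtain ⟨hLkd', hLki'⟩ := lower (r ^ k) Lk hrk1 hLkd hLki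
    have h := logSheetPower_interval_sub_nsmul_mem_relations k hr0 hr1 hrk0 hrk1 hr isAlgebraic_one
      hrk isAlgebraic_one L.neg Lk.neg hLd' hLi' hLkd' hLki'
      (by rw [one_div, one_div, Real.log_inv, Real.log_inv, Real.log_pow, mul_neg])
    have hL : KZ.of L + KZ.of L.neg ∈ KZ.relations :=
      KZ.of_add_of_mem_relations_of_eqOn_neg rfl fun _ _ => rfl
    have hLk : KZ.of Lk + KZ.of Lk.neg ∈ KZ.relations :=
      KZ.of_add_of_mem_relations_of_eqOn_neg rfl fun _ _ => rfl
    have e : KZ.of Lk - k • KZ.of L =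
        (KZ.of Lk + KZ.of Lk.neg) - k • (KZ.of L + KZ.of L.neg) -
          (KZ.of Lk.neg - k • KZ.of L.neg) := by
      rw [nsmul_add]
      abel
    rw [e]
    exact KZ.relations.sub_mem (KZ.relations.sub_mem hLk (KZ.relations.nsmul_mem hL k)) h

end Summit.KontsevichZagierPeriods.HyperbolicBloch.OffTetraSectorKernel

end
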